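import Literature.Combinatorics.Optimization.CpsdRankHadamardMatrices
import HarnessLib

/-!
# Invariances of the cpsd-rank, `cpsd-rank(I_n) = n`, and the symmetrisation `X_sym` (PSVW §3.1–§3.2.1)

Source: A. Prakash, J. Sikora, A. Varvitsiotis, Z. Wei, *Completely positive semidefinite rank*,
Math. Program. 171 (2018) 397–431 = arXiv:1604.07199 [PrakashEtAl2017], §3.1 "Basic properties" and
§3.2.1 (held text `paper:arxiv-1604.07199`, chunks p10–p11). `CompletelyPsdRank.lean` (same
directory) has Definition 1 (`HasCpsdFactorization`), Lemma 3 (`HasCpsdFactorization.add`), Lemma 4,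
Theorem 3 (`PrakashEtAl2017_thm3_holds`) and lists Lemmas 1–2 among the statements not typed;
`CpsdConeNonClosure.lean` / `CpsdRankHadamardMatrices.lean` have reindexing of `CS_+`-factorizations
and `cpsd-rank(I_k) ≥ k`. This
file PROVES the remaining elementary statements of §3.1–§3.2.1:

* **Lemma 1 (i)** (p10): "For any `d × d` unitary matrix `U`, the matrices `{U*P_iU}` are a
  `CS_+`-factorization of `X`": `cpsdFactorization_unitary_conj`.
* **Lemma 2** (p10): "(i) For any diagonal `D` with strictly positive diagonal entries,
  `DXD ∈ CS_+^n` and `cpsd-rank(X) = cpsd-rank(DXD)`. (ii) For any permutation matrix `P`,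
  `PXPᵀ ∈ CS_+^n` and `cpsd-rank(X) = cpsd-rank(PXPᵀ)`": `HasCpsdFactorization.diag_conj`,
  `hasCpsdFactorization_diag_conj_iff`, `hasCpsdFactorization_reindex_iff` (with the tree's
  `HasCpsdFactorization.submatrix` of `CpsdConeNonClosure.lean`).
* **§3.1/§3.2.1** (p10: "This immediately implies `cpsd-rank(I_n) ≥ n`, … which can be easily seen to
  hold with equality"; p11: "it follows by (Theorem 3) that `cpsd-rank(I_n) ≥ n` and this is obviously
  tight"; Remark 3.1: "`cpsd-rank(I_n) = n` and `cpsd-rank(J) = 1`"): `hasCpsdFactorization_smul_one`,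
  `hasCpsdFactorization_one_iff` (lower bound = the tree's `le_of_hasCpsdFactorization_one`,
  `CpsdRankHadamardMatrices.lean`), `hasCpsdFactorization_const`.
* **Remark 3.1** (p10, verbatim): "the cpsd-rank of the sum of a family of cpsd matrices can be
  exponentially smaller compared to any of the individual cpsd-ranks. To see this, let `X ∈ CS_+^n` and
  define `X_sym := Σ_{P ∈ 𝒫_n} PXPᵀ`, where `𝒫_n` is the set of `n × n` permutation matrices. By Lemma 2
  we have `X_sym ∈ CS_+^n` and by its definition we have `X_sym = (a−b)I + bJ`, for appropriate
  constants `a, b` where `a ≥ b ≥ 0`. By Lemma 3 we have `cpsd-rank(X_sym) ≤ n+1`, since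
  `cpsd-rank(I_n) = n` and `cpsd-rank(J) = 1`": `cpsdSymmetrization`, `HasCpsdFactorization.sum`,
  `HasCpsdFactorization.cpsdSymmetrization`, `cpsdSymmetrization_diag_eq`,
  `cpsdSymmetrization_offDiag_eq`, `cpsdSymmetrization_eq_smul_one_add`,
  `hasCpsdFactorization_cpsdSymmetrization_succ` (`cpsd-rank(X_sym) ≤ n + 1`).

All statements PROVED; no named facts. (The other half of Remark 3.1 — a matrix in `CS_+^{2n}` with
cpsd-rank `2^{Ω(√n)}` — is Theorem 16, `PrakashEtAl2017_thm16_holds`.)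
-/

noncomputable section

open Matrix Finset
open scoped MatrixOrder ComplexOrder

namespace Literature.Combinatorics.Optimization

variable {ι : Type*}

/-! ### Lemma 1 (i): unitary invariance of `CS_+`-factorizations -/

/-- **PSVW Lemma 1 (i)** (p10, verbatim): "Let `{P_i} ⊆ H^d_+` be a `CS_+`-factorization for
`X ∈ CS_+^n`. (i) For any `d × d` unitary matrix `U`, the matrices `{U*P_iU} ⊆ H^d_+` are a
`CS_+`-factorization of `X`." [cite: PrakashEtAl2017, Lemma 1 (i) (p10)] -/
theorem cpsdFactorization_unitary_conj {d : ℕ} {X : Matrix ι ι ℝ} {P : ι → Matrix (Fin d) (Fin d) ℂ}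
    (hP : ∀ i, (P i).PosSemidef) (hX : ∀ i j, ((X i j : ℝ) : ℂ) = (P i * P j).trace)
    {U : Matrix (Fin d) (Fin d) ℂ} (hU : U ∈ Matrix.unitaryGroup (Fin d) ℂ) :
    (∀ i, (Uᴴ * P i * U).PosSemidef) ∧ ∀ i j, ((X i j : ℝ) : ℂ) = (Uᴴ * P i * U * (Uᴴ * P j * U)).trace := by
  have hUU : U * Uᴴ = 1 := by
    have h := Matrix.mem_unitaryGroup_iff.mp hU
    rwa [star_eq_conjTranspose] at h
  refine ⟨fun i => (hP i).conjTranspose_mul_mul_same U, fun i j => ?_⟩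
  rw [hX i j]
  calc (P i * P j).trace = (U * Uᴴ * (P i * P j)).trace := by rw [hUU, Matrix.one_mul]
    _ = (Uᴴ * (P i * P j) * U).trace := by rw [Matrix.mul_assoc, Matrix.trace_mul_comm]
    _ = (Uᴴ * P i * U * (Uᴴ * P j * U)).trace := by
        congr 1
        calc Uᴴ * (P i * P j) * U = Uᴴ * P i * (U * Uᴴ) * P j * U := by
              rw [hUU]; simp only [Matrix.mul_assoc, Matrix.one_mul]
          _ = Uᴴ * P i * U * (Uᴴ * P j * U) := by simp only [Matrix.mul_assoc]

/-! ### Lemma 2: diagonal scaling and permutations -/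

/-- **PSVW Lemma 2 (i)**, one direction with nonnegative scalings (p10): a `CS_+`-factorization
`{P_i}` of `X` gives the `CS_+`-factorization `{c_i P_i}` of `DXD`, `D = Diag(c)`, `c ≥ 0`, of the
same size. [cite: PrakashEtAl2017, Lemma 2 (i) (p10)] -/
theorem HasCpsdFactorization.diag_conj [Fintype ι] [DecidableEq ι] {X : Matrix ι ι ℝ} {d : ℕ}
    (h : HasCpsdFactorization X d) {c : ι → ℝ} (hc : ∀ i, 0 ≤ c i) :
    HasCpsdFactorization (diagonal c * X * diagonal c) d := by
  obtain ⟨P, hP, hX⟩ := h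
  refine ⟨fun i => ((c i : ℝ) : ℂ) • P i, fun i => ?_, fun i j => ?_⟩
  · exact (hP i).smul (Complex.zero_le_real.mpr (hc i))
  rw [Matrix.smul_mul, Matrix.mul_smul, smul_smul, trace_smul, ← hX, smul_eq_mul, mul_diagonal,
    diagonal_mul]
  push_cast
  ring

/-- **PSVW Lemma 2 (i)** (p10, verbatim): "For any `n × n` diagonal matrix `D` with strictly positive
diagonal entries we have `DXD ∈ CS_+^n`, and `cpsd-rank(X) = cpsd-rank(DXD)`" — size-wise: `X` and
`DXD` have `CS_+`-factorizations of exactly the same sizes. [cite: PrakashEtAl2017, Lemma 2 (i) (p10)] -/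
theorem hasCpsdFactorization_diag_conj_iff [Fintype ι] [DecidableEq ι] {X : Matrix ι ι ℝ} {d : ℕ}
    {c : ι → ℝ}
    (hc : ∀ i, 0 < c i) :
    HasCpsdFactorization (diagonal c * X * diagonal c) d ↔ HasCpsdFactorization X d := by
  refine ⟨fun h => ?_, fun h => h.diag_conj fun i => (hc i).le⟩
  have h' := h.diag_conj (c := fun i => (c i)⁻¹) fun i => (inv_pos.mpr (hc i)).le
  have hcc : diagonal (fun i => (c i)⁻¹) * diagonal c = (1 : Matrix ι ι ℝ) := by
    rw [diagonal_mul_diagonal, ← diagonal_one]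
    congr 1
    funext i
    exact inv_mul_cancel₀ (hc i).ne'
  have hcc' : diagonal c * diagonal (fun i => (c i)⁻¹) = (1 : Matrix ι ι ℝ) := by
    rw [diagonal_mul_diagonal, ← diagonal_one]
    congr 1
    funext i
    exact mul_inv_cancel₀ (hc i).ne'
  have e : diagonal (fun i => (c i)⁻¹) * (diagonal c * X * diagonal c) * diagonal (fun i => (c i)⁻¹) = X := by
    calc _ = (diagonal (fun i => (c i)⁻¹) * diagonal c) * X * (diagonal c * diagonal (fun i => (c i)⁻¹)) := by
          simp only [Matrix.mul_assoc]
      _ = X := by rw [hcc, hcc', Matrix.one_mul, Matrix.mul_one]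
  rwa [e] at h'

/-- **PSVW Lemma 2 (ii)** (p10, verbatim): "For any `n × n` permutation matrix `P` we have
`PXPᵀ ∈ CS_+^n`, and `cpsd-rank(X) = cpsd-rank(PXPᵀ)`" — size-wise, for a re-indexing along a
bijection `e` (`(PXPᵀ)_{ab} = X_{e(a) e(b)}`); one direction for arbitrary maps is
`HasCpsdFactorization.submatrix` (`CpsdConeNonClosure.lean`). [cite: PrakashEtAl2017, Lemma 2 (ii) (p10)] -/
theorem hasCpsdFactorization_reindex_iff {κ : Type*} {X : Matrix ι ι ℝ} {d : ℕ} (e : κ ≃ ι) :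
    HasCpsdFactorization (X.submatrix e e) d ↔ HasCpsdFactorization X d := by
  refine ⟨fun h => ?_, fun h => h.submatrix e⟩
  have h' := h.submatrix e.symm
  rwa [submatrix_submatrix, Equiv.self_comp_symm, submatrix_id_id] at h'

/-! ### `cpsd-rank(cI_n) ≤ n`, `cpsd-rank(I_n) = n`, `cpsd-rank(cJ) ≤ 1` -/

/-- `cI_n` (`c ≥ 0`) has the `CS_+`-factorization `{√c e_ie_iᵀ}` of size `n` ("`cpsd-rank(I_n) ≥ n`,
… which can be easily seen to hold with equality", p10; "`cpsd-rank(I_n) = n`", Remark 3.1).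
[cite: PrakashEtAl2017, §3.1 (p10), Remark 3.1 (p10)] -/
theorem hasCpsdFactorization_smul_one {n : ℕ} {c : ℝ} (hc : 0 ≤ c) :
    HasCpsdFactorization (c • (1 : Matrix (Fin n) (Fin n) ℝ)) n := by
  classical
  refine ⟨fun i => diagonal (Pi.single i ((Real.sqrt c : ℝ) : ℂ)), fun i => ?_, fun i j => ?_⟩
  · refine posSemidef_diagonal_iff.mpr fun l => ?_
    by_cases hl : l = i
    · subst hl
      rw [Pi.single_eq_same]
      exact Complex.zero_le_real.mpr (Real.sqrt_nonneg c)
    · rw [Pi.single_eq_of_ne hl]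
  · rw [diagonal_mul_diagonal, trace_diagonal, Matrix.smul_apply, one_apply, smul_eq_mul]
    by_cases hij : i = j
    · subst hij
      rw [if_pos rfl, mul_one, Finset.sum_eq_single i]
      · rw [Pi.single_eq_same, ← Complex.ofReal_mul, Real.mul_self_sqrt hc]
      · intro l _ hl
        rw [Pi.single_eq_of_ne hl, mul_zero]
      · intro h; exact absurd (Finset.mem_univ i) h
    · rw [if_neg hij, mul_zero, Complex.ofReal_zero]
      symm
      apply Finset.sum_eq_zero
      intro l _
      by_cases hl : l = i
      · subst hl
        rw [Pi.single_eq_of_ne hij, mul_zero]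
      · rw [Pi.single_eq_of_ne hl, zero_mul]

/-- **`cpsd-rank(I_n) = n`** (p10: "This immediately implies `cpsd-rank(I_n) ≥ n`, … which can be
easily seen to hold with equality"; Remark 3.1; §3.2.1): `I_n` has a `CS_+`-factorization of size `d`
iff `n ≤ d` (the lower bound is the tree's `le_of_hasCpsdFactorization_one`, Gribling–de Laat–Laurent's
"`cpsd-rank_ℂ(I_k) = k`"). [cite: PrakashEtAl2017, §3.1 (p10), Remark 3.1 (p10), §3.2.1 (p11)] -/
theorem hasCpsdFactorization_one_iff {n d : ℕ} :
    HasCpsdFactorization (1 : Matrix (Fin n) (Fin n) ℝ) d ↔ n ≤ d := by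
  refine ⟨le_of_hasCpsdFactorization_one n d, fun h => ?_⟩
  have h1 := hasCpsdFactorization_smul_one (n := n) (c := 1) zero_le_one
  rw [one_smul] at h1
  exact h1.mono h

/-- `cJ` (`c ≥ 0`, `J` the all-ones matrix) has the `CS_+`-factorization `{[√c]}` of size `1`
("`cpsd-rank(J) = 1`", Remark 3.1). [cite: PrakashEtAl2017, Remark 3.1 (p10)] -/
theorem hasCpsdFactorization_const {c : ℝ} (hc : 0 ≤ c) :
    HasCpsdFactorization (Matrix.of fun (_ : ι) (_ : ι) => c) 1 := by
  refine ⟨fun _ => diagonal fun _ => ((Real.sqrt c : ℝ) : ℂ), fun _ =>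
    posSemidef_diagonal_iff.mpr fun _ => Complex.zero_le_real.mpr (Real.sqrt_nonneg c), fun i j => ?_⟩
  rw [diagonal_mul_diagonal, trace_diagonal, of_apply, Fin.sum_univ_one, ← Complex.ofReal_mul,
    Real.mul_self_sqrt hc]

/-! ### Remark 3.1: the symmetrisation `X_sym` -/

/-- `CS_+`-factorizations of a finite sum: sizes add up (Lemma 3 iterated).
[cite: PrakashEtAl2017, Lemma 3 (p10)] -/
theorem HasCpsdFactorization.sum {α : Type*} (s : Finset α) {X : α → Matrix ι ι ℝ} {d : α → ℕ}
    (h : ∀ a ∈ s, HasCpsdFactorization (X a) (d a)) :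
    HasCpsdFactorization (∑ a ∈ s, X a) (∑ a ∈ s, d a) := by
  classical
  induction s using Finset.induction_on with
  | empty =>
    simp only [Finset.sum_empty]
    exact ⟨fun _ => 0, fun _ => PosSemidef.zero, fun i j => by simp⟩
  | insert a s ha ih =>
    rw [Finset.sum_insert ha, Finset.sum_insert ha]
    exact (h a (Finset.mem_insert_self a s)).add (ih fun b hb => h b (Finset.mem_insert_of_mem hb))

/-- **The symmetrisation `X_sym := Σ_{P ∈ 𝒫_n} PXPᵀ`** of Remark 3.1 (p10), the sum over all
permutations `σ` of the re-indexed matrices `(X_{σ(i) σ(j)})`. [cite: PrakashEtAl2017, Remark 3.1 (p10)] -/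
def cpsdSymmetrization {n : ℕ} (X : Matrix (Fin n) (Fin n) ℝ) : Matrix (Fin n) (Fin n) ℝ :=
  ∑ σ : Equiv.Perm (Fin n), X.submatrix σ σ

/-- Entries of `X_sym`. [cite: PrakashEtAl2017, Remark 3.1 (p10)] -/
theorem cpsdSymmetrization_apply {n : ℕ} (X : Matrix (Fin n) (Fin n) ℝ) (i j : Fin n) :
    cpsdSymmetrization X i j = ∑ σ : Equiv.Perm (Fin n), X (σ i) (σ j) := by
  simp only [cpsdSymmetrization, Matrix.sum_apply, submatrix_apply]

/-- "By Lemma 2 we have `X_sym ∈ CS_+^n`" (with Lemma 3; size `n! · d` from a size-`d` factorization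
of `X`). [cite: PrakashEtAl2017, Remark 3.1 (p10)] -/
theorem HasCpsdFactorization.cpsdSymmetrization {n d : ℕ} {X : Matrix (Fin n) (Fin n) ℝ}
    (h : HasCpsdFactorization X d) :
    HasCpsdFactorization (cpsdSymmetrization X) (Nat.factorial n * d) := by
  have hsum := HasCpsdFactorization.sum (Finset.univ : Finset (Equiv.Perm (Fin n)))
    (X := fun σ => X.submatrix σ σ) (d := fun _ => d) fun σ _ => h.submatrix σ
  rwa [Finset.sum_const, Finset.card_univ, Fintype.card_perm, Fintype.card_fin, smul_eq_mul] at hsum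

/-- Re-indexing the sum over permutations: `Σ_σ X_{σ(τk) σ(τl)} = Σ_σ X_{σk σl}`.
[cite: PrakashEtAl2017, Remark 3.1 (p10)] -/
theorem cpsdSymmetrization_apply_perm {n : ℕ} (X : Matrix (Fin n) (Fin n) ℝ) (τ : Equiv.Perm (Fin n))
    (k l : Fin n) : cpsdSymmetrization X (τ k) (τ l) = cpsdSymmetrization X k l := by
  rw [cpsdSymmetrization_apply, cpsdSymmetrization_apply]
  exact Fintype.sum_equiv (Equiv.mulRight τ) _ _ fun σ => by simp [Equiv.Perm.mul_apply]

/-- The diagonal of `X_sym` is constant (`a`). [cite: PrakashEtAl2017, Remark 3.1 (p10)] -/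
theorem cpsdSymmetrization_diag_eq {n : ℕ} (X : Matrix (Fin n) (Fin n) ℝ) (i k : Fin n) :
    cpsdSymmetrization X i i = cpsdSymmetrization X k k := by
  rw [← cpsdSymmetrization_apply_perm X (Equiv.swap k i) k k, Equiv.swap_apply_left]

/-- The off-diagonal entries of `X_sym` are all equal (`b`): for `i ≠ j` and `k ≠ l` there is a
permutation with `k ↦ i`, `l ↦ j`. [cite: PrakashEtAl2017, Remark 3.1 (p10)] -/
theorem cpsdSymmetrization_offDiag_eq {n : ℕ} (X : Matrix (Fin n) (Fin n) ℝ) {i j k l : Fin n}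
    (hij : i ≠ j) (hkl : k ≠ l) : cpsdSymmetrization X i j = cpsdSymmetrization X k l := by
  classical
  -- `τ₁ = swap k i` sends `k ↦ i`; then `τ₂ = swap (τ₁ l) j` sends `τ₁ l ↦ j` and fixes `i`
  set τ₁ : Equiv.Perm (Fin n) := Equiv.swap k i with hτ₁
  have h1 : τ₁ k = i := Equiv.swap_apply_left k i
  have hl' : τ₁ l ≠ i := by
    intro h
    rw [← h1] at h
    exact hkl (τ₁.injective h).symm
  set τ₂ : Equiv.Perm (Fin n) := Equiv.swap (τ₁ l) j with hτ₂
  have h2 : τ₂ (τ₁ l) = j := Equiv.swap_apply_left _ _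
  have h3 : τ₂ i = i := Equiv.swap_apply_of_ne_of_ne hl'.symm hij
  have hτ : (τ₂ * τ₁) k = i ∧ (τ₂ * τ₁) l = j := by
    constructor
    · rw [Equiv.Perm.mul_apply, h1, h3]
    · rw [Equiv.Perm.mul_apply, h2]
  rw [← hτ.1, ← hτ.2, cpsdSymmetrization_apply_perm]

/-- **Remark 3.1, "`X_sym = (a−b)I + bJ` for appropriate constants `a ≥ b ≥ 0`"** (p10), for
`X ∈ CS_+^n`: with `a` the common diagonal and `b` the common off-diagonal value (`b := 0` when `n ≤ 1`),
`b ≥ 0` by entrywise nonnegativity and `a ≥ b` from `(e_i − e_j)ᵀ X_sym (e_i − e_j) = 2(a − b) ≥ 0`.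
[cite: PrakashEtAl2017, Remark 3.1 (p10)] -/
theorem cpsdSymmetrization_eq_smul_one_add {n d : ℕ} {X : Matrix (Fin n) (Fin n) ℝ}
    (h : HasCpsdFactorization X d) :
    ∃ a b : ℝ, b ≤ a ∧ 0 ≤ b ∧
      cpsdSymmetrization X = (a - b) • (1 : Matrix (Fin n) (Fin n) ℝ) + b • Matrix.of fun _ _ => 1 := by
  classical
  have hsym := h.cpsdSymmetrization
  set Y := cpsdSymmetrization X with hY
  rcases Nat.lt_or_ge n 2 with hn | hn
  · -- `n ≤ 1`: no off-diagonal entries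
    rcases Nat.lt_or_ge n 1 with hn0 | hn1
    · have hn0' : n = 0 := by omega
      subst hn0'
      exact ⟨0, 0, le_rfl, le_rfl, by ext i; exact Fin.elim0 i⟩
    · have hn1' : n = 1 := by omega
      subst hn1'
      refine ⟨Y 0 0, 0, hsym.entry_nonneg 0 0, le_rfl, ?_⟩
      ext i j
      fin_cases i; fin_cases j
      simp
  · set i0 : Fin n := ⟨0, by omega⟩ with hi0
    set i1 : Fin n := ⟨1, by omega⟩ with hi1
    have h01 : i0 ≠ i1 := by simp [hi0, hi1]
    set a := Y i0 i0 with ha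
    set b := Y i0 i1 with hb
    have hdiag : ∀ i, Y i i = a := fun i => cpsdSymmetrization_diag_eq X i i0
    have hoff : ∀ i j, i ≠ j → Y i j = b := fun i j hij => cpsdSymmetrization_offDiag_eq X hij h01
    have hb0 : 0 ≤ b := hsym.entry_nonneg i0 i1
    have hab : b ≤ a := by
      -- the principal `2 × 2` minor `[[a, b],[b, a]]` of the psd matrix `X_sym` has `a² − b² ≥ 0`
      have ha0 : 0 ≤ a := hsym.entry_nonneg i0 i0
      have hdet := (hsym.posSemidef.submatrix ![i0, i1]).det_nonneg
      rw [Matrix.det_fin_two] at hdet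
      simp only [submatrix_apply, Matrix.cons_val_zero, Matrix.cons_val_one] at hdet
      rw [hdiag i1, hoff i1 i0 h01.symm] at hdet
      nlinarith
    refine ⟨a, b, hab, hb0, ?_⟩
    ext i j
    rw [Matrix.add_apply, Matrix.smul_apply, Matrix.smul_apply, one_apply, of_apply, smul_eq_mul,
      smul_eq_mul, mul_one]
    by_cases hij : i = j
    · subst hij
      rw [if_pos rfl, hdiag i]
      ring
    · rw [if_neg hij, hoff i j hij]
      ring

/-- **Remark 3.1, "By Lemma 3 we have `cpsd-rank(X_sym) ≤ n+1`, since `cpsd-rank(I_n) = n` and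
`cpsd-rank(J) = 1`"** (p10): for `X ∈ CS_+^n` (of any cpsd-rank `d`), `X_sym` has a
`CS_+`-factorization of size `n + 1`. [cite: PrakashEtAl2017, Remark 3.1 (p10)] -/
theorem hasCpsdFactorization_cpsdSymmetrization_succ {n d : ℕ} {X : Matrix (Fin n) (Fin n) ℝ}
    (h : HasCpsdFactorization X d) : HasCpsdFactorization (cpsdSymmetrization X) (n + 1) := by
  obtain ⟨a, b, hab, hb0, hY⟩ := cpsdSymmetrization_eq_smul_one_add h
  rw [hY]
  have hJ : b • (Matrix.of fun (_ : Fin n) (_ : Fin n) => (1 : ℝ)) = Matrix.of fun _ _ => b := by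
    ext i j
    simp
  rw [hJ]
  exact (hasCpsdFactorization_smul_one (sub_nonneg.mpr hab)).add (hasCpsdFactorization_const hb0)

end Literature.Combinatorics.Optimization
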